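import Literature.Barriers.PneNP.TardosFunctionFP
import Literature.Computability.Complexity.ThetaApproximationProofs
import HarnessLib

/-!
# The monotone gap and the negation-limited gap are theorems (discharges)

Proof file for the barrier facts `Literature.Barriers.PneNP.MonotoneGap` (Tardos 1988; Jukna 2012,
Thm. 9.28) and `Literature.Barriers.PneNP.NegationLimitedGap` (Jukna 2004; Jukna 2012, Thm. 10.21)
of the PneNP barrier catalogue (`MonotoneGap.lean`, `NegationLimitedGap.lean`).

Everything was already in the tree except the final composition:

* the lower-bound half (Alon–Boppana for `(⌊√v⌋ - 1, ⌊√v⌋)`-clique-like functions) is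
  `Jukna2012_cliqueLike_sqrt_lowerBound_holds` (`MonotoneGapLowerBoundProofs.lean`);
* Claim 10.22 is `Jukna2012_claim_10_22_holds` (`NegationLimitedGapProofs.lean`);
* the upper-bound half was reduced in `TardosFunctionFP.lean` to the single named fact
  `Literature.Computability.Complexity.GLS1981_thetaApprox_unary_FP` (`monotoneGap_of_unary`,
  `NegationLimitedGap.of_unary`, `Tardos1988_thetaFn_polysize_of_unary`,
  `Tardos1988_cliqueLike_polysize_of_unary`);
* that fact is PROVED: `Literature.Computability.Complexity.GLS1981_thetaApprox_unary_FP_holds`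
  (`Literature/Computability/Complexity/ThetaApproximationProofs.lean`, the Frank–Wolfe `ϑ` machine).

This file applies the reductions to the discharge, so that the catalogue entries `MonotoneGap`
and `NegationLimitedGap` carry `_holds` theorems and the no-go consequences
(`MonotoneGap.not_monotoneTransfer_pow`, `NegationLimitedGap.not_transfer`,
`NegationLimitedGap.exists_mem_P_not_mem_Pr`) become unconditional.

## References

* É. Tardos, *The gap between monotone and non-monotone circuit complexity is exponential*,
  Combinatorica 8 (1988) 141–142 [Tardos1988].
* S. Jukna, *Boolean Function Complexity* (2012), Lemma 9.27, Thm. 9.28 (PDF p. 286), Thm. 10.21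
  and Claim 10.22 (PDF pp. 310–311) [Jukna2012].
* M. Grötschel, L. Lovász, A. Schrijver, *The ellipsoid method and its consequences in
  combinatorial optimization*, Combinatorica 1 (1981) 169–197, §6 [GrotschelLovaszSchrijver1981].
-/

noncomputable section

namespace Literature.Barriers.PneNP

open Literature.Computability.Complexity

/-- **Tardos 1988 / Jukna 2012, Lemma 9.27 — discharged.** Tardos's `ϑ`-threshold function has
polynomial-size De Morgan circuits: the reduction `Tardos1988_thetaFn_polysize_of_unary` applied to
the proved `GLS1981_thetaApprox_unary_FP_holds`. [cite: Tardos1988, pp. 141–142] [cite: Jukna2012, Lemma 9.27 (PDF p. 286)] -/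
theorem Tardos1988_thetaFn_polysize_holds : Tardos1988_thetaFn_polysize :=
  Tardos1988_thetaFn_polysize_of_unary GLS1981_thetaApprox_unary_FP_holds

/-- **Tardos 1988 / Jukna 2012, Thm. 9.28 (upper-bound half) — discharged.** Some
`(⌊√v⌋ - 1, ⌊√v⌋)`-clique-like monotone function of `v`-vertex graphs has polynomial-size
De Morgan circuits. [cite: Tardos1988, pp. 141–142] [cite: Jukna2012, Thm. 9.28 (PDF p. 286)] -/
theorem Tardos1988_cliqueLike_polysize_holds : Tardos1988_cliqueLike_polysize :=
  Tardos1988_cliqueLike_polysize_of_unary GLS1981_thetaApprox_unary_FP_holds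

/-- **The monotone / non-monotone gap is a theorem** (Tardos 1988; Jukna 2012, Thm. 9.28):
discharge of the barrier fact `MonotoneGap` — an explicit monotone graph function with
polynomial-size De Morgan circuits and monotone complexity `≥ 2^{c v^{1/8}}`.
[cite: Tardos1988, pp. 141–142] [cite: Jukna2012, Thm. 9.26 and Thm. 9.28 (PDF pp. 283–286)] -/
theorem MonotoneGap_holds : Literature.Barriers.PneNP.MonotoneGap :=
  monotoneGap_of_unary GLS1981_thetaApprox_unary_FP_holds

/-- **The negation-limited gap is a theorem** (Jukna 2004; Jukna 2012, Thm. 10.21): discharge of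
the barrier fact `NegationLimitedGap` — an explicit feasible monotone multi-output function that
needs `2^{c (log₂ n)²}` gates on De Morgan circuits with at most `log₂ n - C₀ log₂ log₂ n` NOT
gates. [cite: Jukna2012, Thm. 10.21 (PDF pp. 310–311)] [cite: Jukna2004] -/
theorem NegationLimitedGap_holds : Literature.Barriers.PneNP.NegationLimitedGap :=
  NegationLimitedGap.of_unary GLS1981_thetaApprox_unary_FP_holds

/-- Unconditional form of `MonotoneGap.not_monotoneTransfer_pow`: no polynomial transfer
`(v + t)^p` from monotone to general circuit size. [cite: Jukna2012, Thm. 9.28 (PDF p. 286)] -/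
theorem not_monotoneTransfer_pow_holds (p : ℕ) : ¬ MonotoneTransfer fun v t => (v + t) ^ p :=
  MonotoneGap_holds.not_monotoneTransfer_pow p

/-- Unconditional form of `MonotoneGap.not_monotoneTransfer_of_eventually_lt` (barrier audit
2026-08-16): no transfer with any loss that is monotone in the circuit size and eventually below
`2^{c v^{1/8}}` along every polynomial, for every `c > 0`. [cite: Tardos1988, p. 141] [cite: Jukna2012, Thm. 9.28 (PDF p. 286)] -/
theorem not_monotoneTransfer_of_eventually_lt_holds {s : ℕ → ℕ → ℕ} (hmono : ∀ v, Monotone (s v))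
    (hsmall : ∀ (k : ℕ) (c : ℝ), 0 < c → ∀ᶠ v : ℕ in Filter.atTop,
      (s v (v ^ k) : ℝ) < (2 : ℝ) ^ (c * (v : ℝ) ^ (1 / 8 : ℝ))) :
    ¬ MonotoneTransfer s :=
  MonotoneGap_holds.not_monotoneTransfer_of_eventually_lt hmono hsmall

/-- Unconditional form of `MonotoneGap.not_monotoneTransfer_quasipoly` (barrier audit
2026-08-16): no quasi-polynomial transfer from monotone to general circuit size.
[cite: Tardos1988, p. 141] [cite: Jukna2012, Thm. 9.28 (PDF p. 286)] -/
theorem not_monotoneTransfer_quasipoly_holds (q : ℕ) {s : ℕ → ℕ → ℕ} (hmono : ∀ v, Monotone (s v))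
    (hs : ∀ v t : ℕ, (s v t : ℝ) ≤ (2 : ℝ) ^ Real.log ((v : ℝ) + t + 2) ^ q) :
    ¬ MonotoneTransfer s :=
  MonotoneGap_holds.not_monotoneTransfer_quasipoly q hmono hs

/-- Unconditional form of `MonotoneGap.lowerBound_of_restrictedTransfer` (barrier audit
2026-08-16): a polynomial monotone-to-general transfer valid on a sub-class `R` of De Morgan
circuits yields a monotone graph function with polynomial-size De Morgan circuits none of whose
polynomial-size De Morgan circuits lies in `R` (eventually, for every polynomial).
[cite: CavalarOliveira2023, Thm. 1.3 and §4.2 Thm. 4.8] [cite: Tardos1988, p. 141] -/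
theorem lowerBound_of_restrictedTransfer_holds
    (R : ∀ v : ℕ, Circuit ((⊤ : SimpleGraph (Fin v)).edgeSet) → Prop) (p : ℕ)
    (hT : ∀ᶠ v : ℕ in Filter.atTop, ∀ f : (((⊤ : SimpleGraph (Fin v)).edgeSet → Bool) → Bool),
      Monotone f → ∀ C : Circuit ((⊤ : SimpleGraph (Fin v)).edgeSet), C.IsOver deMorganBasis →
        C.Computes f → R v C → circuitSizeOver monotoneBasis f ≤ (v + C.size) ^ p) :
    ∃ T : ∀ v : ℕ, (((⊤ : SimpleGraph (Fin v)).edgeSet → Bool) → Bool),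
      (∀ v, Monotone (T v)) ∧
      (∃ k : ℕ, ∀ᶠ v : ℕ in Filter.atTop, ∃ C : Circuit ((⊤ : SimpleGraph (Fin v)).edgeSet),
        C.IsOver deMorganBasis ∧ C.Computes (T v) ∧ C.size ≤ v ^ k) ∧
      ∀ q : ℕ, ∀ᶠ v : ℕ in Filter.atTop, ∀ C : Circuit ((⊤ : SimpleGraph (Fin v)).edgeSet),
        C.IsOver deMorganBasis → C.Computes (T v) → R v C → v ^ q < C.size :=
  MonotoneGap_holds.lowerBound_of_restrictedTransfer R p hT

end Literature.Barriers.PneNP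

end
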